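import Literature.Topology.FourManifolds.KirbyMovesSlideEndData2
import HarnessLib

/-!
# Normalising the band end: the base lift of the band end along the whole attaching arc

Topic `Literature/Topology/FourManifolds`; fact seat `provefact-IsStrictHandleSlide.isSurgery`
(R. C. Kirby, *The Topology of 4-Manifolds*, LNM 1374 (1989), Ch. I §4; remaining content: the
named fact (S) `Literature.Topology.FourManifolds.FramedLink.IsStrictHandleSlide.slideModel`).
`KirbyMovesSlideEndData2.lean` lifted the base coordinate `U x = (ν⁻¹ (band x)).1 ∈ S¹` of the
band end to an angle near one edge point, with a fixed centre. Here the centre moves with the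
height: for `x = (x₀, x₁)` near the right edge,
`Θ x = thetaB x₁ + (2π)⁻¹ arcsin (cos (2π thetaB x₁) (U x)₁ - sin (2π thetaB x₁) (U x)₀)`
is a smooth lift of `U` (`circlePt (Θ x) = U x`) on an open set containing the whole open edge
segment `{(1, y) : 1/10 < y < 9/10}`, equal to `thetaB` on the edge. In these coordinates the band
end reads `band x = ν (circlePt (Θ x), W x)` — the chart in which the end is flattened
(step B of the normalisation). Proved here (no definitions — `Θ` is used as an expression — and
no named facts):

* `Literature.Topology.FourManifolds.BandCore.isOpen_baseLiftDom`,
  `Literature.Topology.FourManifolds.BandCore.pt2_one_mem_baseLiftDom` — the domain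
  `{x | band x ∈ ν(S¹ × ℝ²), 1/10 < x₁ < 9/10, ⟪circlePt (thetaB x₁), U x⟫ > 0}` is open and
  contains the open edge segment;
* `Literature.Topology.FourManifolds.BandCore.circlePt_baseLift` — `circlePt (Θ x) = U x` there;
* `Literature.Topology.FourManifolds.BandCore.band_eq_tube_baseLift` — `band x = ν (circlePt (Θ x), W x)` there;
* `Literature.Topology.FourManifolds.BandCore.baseLift_pt2_one` — `Θ (1, y) = thetaB y`;
* `Literature.Topology.FourManifolds.BandCore.contDiffOn_baseLift` — `Θ` is `C^∞` on the domain.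

## References

* R. C. Kirby, *The Topology of 4-Manifolds*, LNM 1374, Springer (1989), Ch. I §4. [Kirby1989]
-/

open scoped Manifold ContDiff Topology
open Function Set Metric

noncomputable section

namespace Literature.Topology.FourManifolds

namespace BandCore

variable [Knot.TubularNbhd.SmoothnessFacts] {A Kj : Knot} (ν : Knot.TubularNbhd Kj)
  {avoid : Set (Metric.sphere (0 : EuclideanSpace ℝ (Fin 4)) 1)} (b : BandCore A ν.pushOff avoid)

/-- **The domain of the base lift is open.** [folklore] -/
theorem isOpen_baseLiftDom :
    IsOpen {x : EuclideanSpace ℝ (Fin 2) | x ∈ b.band ⁻¹' range ⇑ν ∧ x 1 ∈ Ioo (10⁻¹ : ℝ) (9 / 10) ∧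
      0 < Real.cos (2 * Real.pi * b.thetaB (x 1)) *
            ((ν.toTubeNbhd.toHomeo.symm (b.band x)).1 : EuclideanSpace ℝ (Fin 2)) 0 +
          Real.sin (2 * Real.pi * b.thetaB (x 1)) *
            ((ν.toTubeNbhd.toHomeo.symm (b.band x)).1 : EuclideanSpace ℝ (Fin 2)) 1} := by
  have hO := b.isOpen_preimage_range_tube ν
  have hproj : Continuous (fun x : EuclideanSpace ℝ (Fin 2) ↦ x 1) := (EuclideanSpace.proj (1 : Fin 2)).continuous
  -- the strip `1/10 < x₁ < 9/10` inside `O`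
  have h1 : IsOpen {x : EuclideanSpace ℝ (Fin 2) | x ∈ b.band ⁻¹' range ⇑ν ∧ x 1 ∈ Ioo (10⁻¹ : ℝ) (9 / 10)} :=
    hO.and (isOpen_Ioo.preimage hproj)
  -- the positivity condition is continuous on that open set
  have hUc : ContinuousOn (fun x ↦ ((ν.toTubeNbhd.toHomeo.symm (b.band x)).1 : EuclideanSpace ℝ (Fin 2)))
      (b.band ⁻¹' range ⇑ν) := (b.contDiffOn_tubeBaseCoe ν).continuousOn
  have hth : ContinuousOn (fun x : EuclideanSpace ℝ (Fin 2) ↦ b.thetaB (x 1))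
      {x : EuclideanSpace ℝ (Fin 2) | x ∈ b.band ⁻¹' range ⇑ν ∧ x 1 ∈ Ioo (10⁻¹ : ℝ) (9 / 10)} := by
    intro x hx
    have h := (b.contDiffAt_thetaB hx.2).continuousAt
    exact (ContinuousAt.comp (f := fun x : EuclideanSpace ℝ (Fin 2) ↦ x 1) h hproj.continuousAt).continuousWithinAt
  have hf : ContinuousOn (fun x : EuclideanSpace ℝ (Fin 2) ↦
      Real.cos (2 * Real.pi * b.thetaB (x 1)) *
            ((ν.toTubeNbhd.toHomeo.symm (b.band x)).1 : EuclideanSpace ℝ (Fin 2)) 0 +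
          Real.sin (2 * Real.pi * b.thetaB (x 1)) *
            ((ν.toTubeNbhd.toHomeo.symm (b.band x)).1 : EuclideanSpace ℝ (Fin 2)) 1)
      {x : EuclideanSpace ℝ (Fin 2) | x ∈ b.band ⁻¹' range ⇑ν ∧ x 1 ∈ Ioo (10⁻¹ : ℝ) (9 / 10)} := by
    have hU' := hUc.mono (fun x (hx : x ∈ {x : EuclideanSpace ℝ (Fin 2) |
      x ∈ b.band ⁻¹' range ⇑ν ∧ x 1 ∈ Ioo (10⁻¹ : ℝ) (9 / 10)}) ↦ hx.1)
    have hU0 : ContinuousOn (fun x ↦ ((ν.toTubeNbhd.toHomeo.symm (b.band x)).1 : EuclideanSpace ℝ (Fin 2)) 0) _ :=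
      (EuclideanSpace.proj (0 : Fin 2)).continuous.comp_continuousOn hU'
    have hU1 : ContinuousOn (fun x ↦ ((ν.toTubeNbhd.toHomeo.symm (b.band x)).1 : EuclideanSpace ℝ (Fin 2)) 1) _ :=
      (EuclideanSpace.proj (1 : Fin 2)).continuous.comp_continuousOn hU'
    exact ((Real.continuous_cos.comp_continuousOn (continuousOn_const.mul hth)).mul hU0).add
      ((Real.continuous_sin.comp_continuousOn (continuousOn_const.mul hth)).mul hU1)
  have := hf.isOpen_inter_preimage h1 isOpen_Ioi (t := Ioi (0 : ℝ))
  convert this using 1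
  ext x
  simp only [mem_setOf_eq, mem_inter_iff, mem_preimage, mem_Ioi]
  tauto

/-- The open edge segment lies in the domain of the base lift. [folklore] -/
theorem pt2_one_mem_baseLiftDom {y : ℝ} (hy : y ∈ Ioo (10⁻¹ : ℝ) (9 / 10)) :
    pt2 1 y ∈ b.band ⁻¹' range ⇑ν ∧ (pt2 1 y : EuclideanSpace ℝ (Fin 2)) 1 ∈ Ioo (10⁻¹ : ℝ) (9 / 10) ∧
      0 < Real.cos (2 * Real.pi * b.thetaB ((pt2 1 y : EuclideanSpace ℝ (Fin 2)) 1)) *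
            ((ν.toTubeNbhd.toHomeo.symm (b.band (pt2 1 y))).1 : EuclideanSpace ℝ (Fin 2)) 0 +
          Real.sin (2 * Real.pi * b.thetaB ((pt2 1 y : EuclideanSpace ℝ (Fin 2)) 1)) *
            ((ν.toTubeNbhd.toHomeo.symm (b.band (pt2 1 y))).1 : EuclideanSpace ℝ (Fin 2)) 1 := by
  have hyc : y ∈ Icc (10⁻¹ : ℝ) (9 / 10) := Ioo_subset_Icc_self hy
  have h1 : (pt2 1 y : EuclideanSpace ℝ (Fin 2)) 1 = y := rfl
  refine ⟨b.band_pt2_one_mem_range ν hyc, by rw [h1]; exact hy, ?_⟩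
  rw [h1, b.tubeBase_band_pt2_one ν hyc, circlePt_apply_zero, circlePt_apply_one]
  nlinarith [Real.cos_sq_add_sin_sq (2 * Real.pi * b.thetaB y)]

/-- **The base lift lifts the base coordinate**: `circlePt (Θ x) = U x` on the domain. [folklore] -/
theorem circlePt_baseLift {x : EuclideanSpace ℝ (Fin 2)}
    (hpos : 0 < Real.cos (2 * Real.pi * b.thetaB (x 1)) *
            ((ν.toTubeNbhd.toHomeo.symm (b.band x)).1 : EuclideanSpace ℝ (Fin 2)) 0 +
          Real.sin (2 * Real.pi * b.thetaB (x 1)) *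
            ((ν.toTubeNbhd.toHomeo.symm (b.band x)).1 : EuclideanSpace ℝ (Fin 2)) 1) :
    circlePt (b.thetaB (x 1) + (2 * Real.pi)⁻¹ *
        Real.arcsin (Real.cos (2 * Real.pi * b.thetaB (x 1)) *
              ((ν.toTubeNbhd.toHomeo.symm (b.band x)).1 : EuclideanSpace ℝ (Fin 2)) 1 -
            Real.sin (2 * Real.pi * b.thetaB (x 1)) *
              ((ν.toTubeNbhd.toHomeo.symm (b.band x)).1 : EuclideanSpace ℝ (Fin 2)) 0)) =
      (ν.toTubeNbhd.toHomeo.symm (b.band x)).1 := by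
  rw [circlePt_eq_circlePoint, mul_add, ← mul_assoc, mul_inv_cancel₀ (by positivity : (2 * Real.pi : ℝ) ≠ 0),
    one_mul]
  exact SlideSweep.circlePoint_baseLift _ _ hpos

/-- **The band end in the moving-centre coordinates**: `band x = ν (circlePt (Θ x), W x)` on the
domain of the base lift. [folklore] -/
theorem band_eq_tube_baseLift {x : EuclideanSpace ℝ (Fin 2)} (hx : x ∈ b.band ⁻¹' range ⇑ν)
    (hpos : 0 < Real.cos (2 * Real.pi * b.thetaB (x 1)) *
            ((ν.toTubeNbhd.toHomeo.symm (b.band x)).1 : EuclideanSpace ℝ (Fin 2)) 0 +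
          Real.sin (2 * Real.pi * b.thetaB (x 1)) *
            ((ν.toTubeNbhd.toHomeo.symm (b.band x)).1 : EuclideanSpace ℝ (Fin 2)) 1) :
    b.band x = ν (circlePt (b.thetaB (x 1) + (2 * Real.pi)⁻¹ *
        Real.arcsin (Real.cos (2 * Real.pi * b.thetaB (x 1)) *
              ((ν.toTubeNbhd.toHomeo.symm (b.band x)).1 : EuclideanSpace ℝ (Fin 2)) 1 -
            Real.sin (2 * Real.pi * b.thetaB (x 1)) *
              ((ν.toTubeNbhd.toHomeo.symm (b.band x)).1 : EuclideanSpace ℝ (Fin 2)) 0)),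
      (ν.toTubeNbhd.toHomeo.symm (b.band x)).2) := by
  rw [b.circlePt_baseLift ν hpos, Prod.mk.eta]
  have htgt : b.band x ∈ ν.toTubeNbhd.toHomeo.target := by
    rw [TubeNbhd.toHomeo_target]
    obtain ⟨q, hq⟩ := (show b.band x ∈ range ⇑ν from hx)
    exact ⟨q, by rw [Knot.TubularNbhd.toTubeNbhd_toFun]; exact hq⟩
  have h := ν.toTubeNbhd.toHomeo.right_inv htgt
  rw [TubeNbhd.toHomeo_apply, Knot.TubularNbhd.toTubeNbhd_toFun] at h
  exact h.symm

/-- **On the edge the base lift is `thetaB`.** [folklore] -/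
theorem baseLift_pt2_one {y : ℝ} (hy : y ∈ Icc (10⁻¹ : ℝ) (9 / 10)) :
    b.thetaB ((pt2 1 y : EuclideanSpace ℝ (Fin 2)) 1) + (2 * Real.pi)⁻¹ *
        Real.arcsin (Real.cos (2 * Real.pi * b.thetaB ((pt2 1 y : EuclideanSpace ℝ (Fin 2)) 1)) *
              ((ν.toTubeNbhd.toHomeo.symm (b.band (pt2 1 y))).1 : EuclideanSpace ℝ (Fin 2)) 1 -
            Real.sin (2 * Real.pi * b.thetaB ((pt2 1 y : EuclideanSpace ℝ (Fin 2)) 1)) *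
              ((ν.toTubeNbhd.toHomeo.symm (b.band (pt2 1 y))).1 : EuclideanSpace ℝ (Fin 2)) 0) =
      b.thetaB y := by
  have h1 : (pt2 1 y : EuclideanSpace ℝ (Fin 2)) 1 = y := rfl
  rw [h1, b.tubeBase_band_pt2_one ν hy, circlePt_apply_zero, circlePt_apply_one]
  have : Real.cos (2 * Real.pi * b.thetaB y) * Real.sin (2 * Real.pi * b.thetaB y) -
      Real.sin (2 * Real.pi * b.thetaB y) * Real.cos (2 * Real.pi * b.thetaB y) = 0 := by ring
  rw [this, Real.arcsin_zero, mul_zero, add_zero]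

/-- **The base lift is smooth on its domain.** [folklore] -/
theorem contDiffOn_baseLift :
    ContDiffOn ℝ ∞ (fun x : EuclideanSpace ℝ (Fin 2) ↦ b.thetaB (x 1) + (2 * Real.pi)⁻¹ *
        Real.arcsin (Real.cos (2 * Real.pi * b.thetaB (x 1)) *
              ((ν.toTubeNbhd.toHomeo.symm (b.band x)).1 : EuclideanSpace ℝ (Fin 2)) 1 -
            Real.sin (2 * Real.pi * b.thetaB (x 1)) *
              ((ν.toTubeNbhd.toHomeo.symm (b.band x)).1 : EuclideanSpace ℝ (Fin 2)) 0))
      {x : EuclideanSpace ℝ (Fin 2) | x ∈ b.band ⁻¹' range ⇑ν ∧ x 1 ∈ Ioo (10⁻¹ : ℝ) (9 / 10) ∧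
        0 < Real.cos (2 * Real.pi * b.thetaB (x 1)) *
              ((ν.toTubeNbhd.toHomeo.symm (b.band x)).1 : EuclideanSpace ℝ (Fin 2)) 0 +
            Real.sin (2 * Real.pi * b.thetaB (x 1)) *
              ((ν.toTubeNbhd.toHomeo.symm (b.band x)).1 : EuclideanSpace ℝ (Fin 2)) 1} := by
  haveI := fact_finrank_euclideanSpace_succ 1
  intro x hx
  obtain ⟨hxO, hx1, hpos⟩ := hx
  have hO := b.isOpen_preimage_range_tube ν
  -- smoothness of the ingredients at `x`
  have hth : ContDiffAt ℝ ∞ (fun x : EuclideanSpace ℝ (Fin 2) ↦ b.thetaB (x 1)) x :=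
    (b.contDiffAt_thetaB hx1).comp x (contDiff_euclidean.1 contDiff_id 1).contDiffAt
  have hUc : ContDiffAt ℝ ∞ (fun x ↦ ((ν.toTubeNbhd.toHomeo.symm (b.band x)).1 : EuclideanSpace ℝ (Fin 2))) x :=
    (b.contDiffOn_tubeBaseCoe ν).contDiffAt (hO.mem_nhds hxO)
  have hU0 : ContDiffAt ℝ ∞ (fun x ↦ ((ν.toTubeNbhd.toHomeo.symm (b.band x)).1 : EuclideanSpace ℝ (Fin 2)) 0) x :=
    (contDiff_euclidean.1 contDiff_id 0).contDiffAt.comp x hUc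
  have hU1 : ContDiffAt ℝ ∞ (fun x ↦ ((ν.toTubeNbhd.toHomeo.symm (b.band x)).1 : EuclideanSpace ℝ (Fin 2)) 1) x :=
    (contDiff_euclidean.1 contDiff_id 1).contDiffAt.comp x hUc
  have hcos : ContDiffAt ℝ ∞ (fun x : EuclideanSpace ℝ (Fin 2) ↦ Real.cos (2 * Real.pi * b.thetaB (x 1))) x :=
    Real.contDiff_cos.contDiffAt.comp x (contDiffAt_const.mul hth)
  have hsin : ContDiffAt ℝ ∞ (fun x : EuclideanSpace ℝ (Fin 2) ↦ Real.sin (2 * Real.pi * b.thetaB (x 1))) x :=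
    Real.contDiff_sin.contDiffAt.comp x (contDiffAt_const.mul hth)
  have harg : ContDiffAt ℝ ∞ (fun x : EuclideanSpace ℝ (Fin 2) ↦
      Real.cos (2 * Real.pi * b.thetaB (x 1)) *
            ((ν.toTubeNbhd.toHomeo.symm (b.band x)).1 : EuclideanSpace ℝ (Fin 2)) 1 -
          Real.sin (2 * Real.pi * b.thetaB (x 1)) *
            ((ν.toTubeNbhd.toHomeo.symm (b.band x)).1 : EuclideanSpace ℝ (Fin 2)) 0) x :=
    (hcos.mul hU1).sub (hsin.mul hU0)
  -- the argument of `arcsin` lies in `(-1, 1)` (the inner product is positive)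
  set u := ((ν.toTubeNbhd.toHomeo.symm (b.band x)).1 : EuclideanSpace ℝ (Fin 2)) with hu
  set c := Real.cos (2 * Real.pi * b.thetaB (x 1)) with hc
  set s := Real.sin (2 * Real.pi * b.thetaB (x 1)) with hs
  have hu1 : u 0 ^ 2 + u 1 ^ 2 = 1 := by
    have h := norm_eq_of_mem_sphere (ν.toTubeNbhd.toHomeo.symm (b.band x)).1
    rw [EuclideanSpace.norm_eq, Fin.sum_univ_two, Real.sqrt_eq_one] at h
    simpa [sq_abs] using h
  have hcs : c ^ 2 + s ^ 2 = 1 := Real.cos_sq_add_sin_sq _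
  have hid : (c * u 1 - s * u 0) ^ 2 + (c * u 0 + s * u 1) ^ 2 = 1 := by
    have : (c * u 1 - s * u 0) ^ 2 + (c * u 0 + s * u 1) ^ 2 = (c ^ 2 + s ^ 2) * (u 0 ^ 2 + u 1 ^ 2) := by ring
    rw [this, hcs, hu1, one_mul]
  have hlt : (c * u 1 - s * u 0) ^ 2 < 1 := by nlinarith [hpos]
  have hne1 : c * u 1 - s * u 0 ≠ 1 := fun h ↦ by rw [h] at hlt; norm_num at hlt
  have hne2 : c * u 1 - s * u 0 ≠ -1 := fun h ↦ by rw [h] at hlt; norm_num at hlt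
  have harc : ContDiffAt ℝ ∞ Real.arcsin (c * u 1 - s * u 0) := Real.contDiffAt_arcsin hne2 hne1
  exact (hth.add (contDiffAt_const.mul (harc.comp x harg))).contDiffWithinAt

end BandCore

end Literature.Topology.FourManifolds
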